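import Summits.QuantumFields.YangMills.Theorems.FreeEnergyWindowChannel.Negative.TorusRemainderRigidity
import Summits.QuantumFields.YangMills.Theorems.ConvexGribovBodyNonSimplyConnectedLatticeGapAdmissibleInstance
import Literature.MathematicalPhysics.QuantumFieldTheory.WilsonFinTorusPartitionComplex
import HarnessLib

/-!
# The symmetric-torus remainder is a transport invariant: `FreeEnergyWindowChannel` forces it to vanish,
# so the crux is false modulo 't Hooft flux degeneracy of `SO(3)` lattice gauge theory

Crux `FreeEnergyWindowChannel` (stmt-QuantumFields-18842, route `ComplexCouplingChannel` of `QuantumFields/YangMills`),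
line `Sketch` (idea `log-envelope-transport`, crux-ideate k2), NEGATION HALF (the k2 sketch's
`torusRemainder_tendsto_zero_of_channel` / `not_freeEnergyWindowChannel_of_torusRemainder`), lead c2.

The crux asks, for EVERY compact simple `G` (tree sense: connected, non-abelian, closed connected normal subgroups
trivial, a faithful unitary representation exists — centre-free quotients such as `SO(3)` are admitted, tree
`isCompactSimpleLieGroup_SO3`) and every faithful unitary `r`, beyond some `β₁`, for every `β ≥ β₁` and `ρ > 0`, for an
open connected `D ∋ β` through a real `x`, `|x| < ρ`, one holomorphic `f` on `D` and a constant `M` with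
`Z_P z ≠ 0 ∧ |log ‖Z_P z‖ + P⁴ Re f z| ≤ M` for all large `P`, where `Z_P z = wilsonFinTorusPartitionC r.ρ z P P P P` is the
complex-coupling Wilson partition function of the symmetric torus `P⁴`.

THE COMPANION FILE `TorusRemainderRigidity.lean` PROVES (sorry-free, imported here):

* `remainder_tendsto_zero_of_window_of_pinning` — abstract one-variable engine: a window `|log ‖Z_P‖ + P⁴ Re f| ≤ M` on an
  open preconnected `D`, PINNED to `ε_P → 0` on a neighbourhood of one point of `D`, tends to `0` at EVERY point of `D`
  (the landed real-part two-constants chain `stub_reChain`: `|u| ≤ C₀ ε^θ B^{1-θ}`).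
* `torusRemainder_tendsto_zero_of_freeEnergyWindowChannel` — **the torus remainder is a transport invariant**: the crux
  and the PROVED strong-coupling anchor (`complexStrongCouplingAnchor_proof`: `|log ‖Z_P‖ + P⁴ Re f_A| ≤ C P⁴ e^{-cP}` on
  `‖z‖ < ρ₀`) force, for every admissible `(G, r)` and every `β ≥ β₁`, a real constant `F` (namely `Re f β`) with
  `log Z_P(β) + P⁴ F → 0` as `P → ∞`: on the overlap `D ∩ {‖z‖ < ρ₀}` the two windows pin `Re f = Re f_A`
  (Archimedean step `nonpos_of_forall_pow_four_mul_le`), so the remainder is `O(P⁴ e^{-cP})` there, and the chain carries the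
  smallness to `β`.  In words: the constant term `κ(β)` of `log Z_P(β) = -P⁴ f(β) + κ(β) + o(1)` is `0` on the anchor disc
  (cluster expansion) and CANNOT CHANGE along any zero-free window channel — whatever complex detour the channel takes.
* `doublingRemainder_tendsto_zero_of_freeEnergyWindowChannel` — the `F`-free form: `log Z_{2P}(β) − 16 log Z_P(β) → 0`.
* `not_freeEnergyWindowChannel_of_torusRemainder` — hence, for any admissible `(G, r)`: if at arbitrarily large real `β`
  the remainder `log Z_P(β) + P⁴ F` fails to tend to `0` for EVERY real `F`, the crux is false;
  `not_freeEnergyWindowChannel_of_doublingRemainder` — the same from the doubling form.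

THIS FILE: `So3TorusRemainderNonvanishing` (H, physics, REAL coupling, one lattice gauge theory) and the negative lemma
`FreeEnergyWindowChannel_false_of_So3TorusRemainderNonvanishing : H → ¬ FreeEnergyWindowChannel`.

WHY H IS THE EXPECTED PHYSICS (not provable here — confinement grade).  `SO(3) = SU(2)/ℤ₂` is admissible
(`isCompactSimpleLieGroup_SO3`, `nonempty_latticeRep_SO3`, Borel σ-algebra).  Its Wilson lattice gauge theory is the
`SU(2)` theory with an adjoint-type (centre-blind) action; at weak coupling, where `ℤ₂` monopoles are suppressed, it is the
`SU(2)` theory summed over all 't Hooft twist sectors `H²(T⁴; ℤ₂)` (de Forcrand–Jahn, Nucl. Phys. B 651 (2003) 125,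
hep-lat/0211004; hep-lat/0205026 §5), and in the confined regime `P → ∞` every twist sector becomes degenerate with the
untwisted one (magnetic-flux free energy `→ 0`: 't Hooft, Nucl. Phys. B 153 (1979) 141; Kovács–Tomboulis, Phys. Rev.
Lett. 85 (2000) 704; de Forcrand–von Smekal, Phys. Rev. D 66 (2002) 011504), so `log Z_P(β) = -P⁴ f(β) + κ + o(1)` with
`κ = log (|H²|·|H⁰|/|H¹|) = log 8 ≠ 0` (the `T⁴` partition function of the infrared `ℤ₂` 2-form gauge theory,
Gaiotto–Kapustin–Seiberg–Willett, JHEP 02 (2015) 172, arXiv:1412.5148); at strong coupling `κ = 0` is a THEOREM (the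
anchor).  By the invariant no window channel — real or complex — joins the two: the crux as typed (`∀` compact simple `G`)
fails at `(SO(3), r)`.  For simply connected `G` (`SU(N)`, unique confined vacuum, no flux sectors) `κ = 0` is expected
and the invariant raises no obstruction; the natural repair of the crux is the hypothesis `[SimplyConnectedSpace G]`
(planners' call).  Note that the route's own `HarmonicMeasureEngine` needs `κ = 0` downstream (thermal trace `→ 0`).

References: R. Nevanlinna, *Eindeutige analytische Funktionen* (1936) §III.2 (two-constants theorem); route file
`Summits/QuantumFields/YangMills/Theses/ComplexCouplingChannel.lean`; crux idea cards
`Summits/QuantumFields/YangMills/Cruxes/FreeEnergyWindowChannel/Ideas/{log-envelope-transport,flux-sector-torus-constant}.md`.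
-/

set_option autoImplicit false

noncomputable section

open scoped Topology
open MeasureTheory Filter Set Metric Complex
open Literature.MathematicalPhysics.QuantumFieldTheory
open Literature.AlgebraicTopology.FundamentalGroup (SO3)
open Summit.QuantumFields.YangMills.Theorems.NonSimplyConnectedLatticeGap
  (so3_isTopologicalGroup so3_compactSpace isCompactSimpleLieGroup_SO3)

namespace Summit.QuantumFields.YangMills.Theorems.FreeEnergyWindowChannel.Negative

/-- **H — 't Hooft flux degeneracy of `SO(3)` lattice gauge theory, in its weakest real-coupling form** (physics;
confinement grade; the object the tree cannot yet construct).  For SOME faithful unitary representation `r` of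
`SO(3)` (Borel σ-algebra; the defining one is the intended instance), at arbitrarily large real couplings `β` the
symmetric-torus remainder `log Z(β; P⁴) + P⁴ F` of the Wilson lattice gauge theory fails to tend to `0` as `P → ∞` for
EVERY real constant `F`.  Expected: `log Z(β; P⁴) = -P⁴ f(β) + log 8 + o(1)` at weak coupling (eight degenerate
`ℤ₂` magnetic-flux sectors of `SU(2)/ℤ₂` on `T⁴`, TQFT-normalised count `|H²|·|H⁰|/|H¹| = 64·2/16`), versus the PROVED
`+ o(1)` (`κ = 0`) on the strong-coupling disc.  Hypothesis of the negative lemma; NOT a literature fact (no theorem in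
print) — it must stay in this file. -/
def So3TorusRemainderNonvanishing : Prop :=
  haveI : IsTopologicalGroup SO3 := so3_isTopologicalGroup
  haveI : CompactSpace SO3 := so3_compactSpace
  letI : MeasurableSpace SO3 := borel SO3
  haveI : BorelSpace SO3 := ⟨rfl⟩
  ∃ r : LatticeRep SO3, ∀ b : ℝ, ∃ β : ℝ, b ≤ β ∧ ∀ F : ℝ,
    ¬ Tendsto (fun P : ℕ => Real.log (wilsonFinTorusPartition r.ρ β P P P P) + (P : ℝ) ^ 4 * F) atTop (𝓝 0)

/-- **`FreeEnergyWindowChannel` is false modulo H** (`So3TorusRemainderNonvanishing`): `SO(3)` with its Borel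
σ-algebra is an admissible gauge group of the crux (`isCompactSimpleLieGroup_SO3`, instances `so3_isTopologicalGroup`,
`so3_compactSpace`), so the transport invariant `not_freeEnergyWindowChannel_of_torusRemainder` applies to it.
[folklore] -/
theorem FreeEnergyWindowChannel_false_of_So3TorusRemainderNonvanishing :
    So3TorusRemainderNonvanishing →
      ¬ Summit.QuantumFields.YangMills.Theses.ComplexCouplingChannel.FreeEnergyWindowChannel := by
  intro hH
  haveI : IsTopologicalGroup SO3 := so3_isTopologicalGroup
  haveI : CompactSpace SO3 := so3_compactSpace
  letI : MeasurableSpace SO3 := borel SO3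
  haveI : BorelSpace SO3 := ⟨rfl⟩
  obtain ⟨r, hr⟩ := hH
  exact not_freeEnergyWindowChannel_of_torusRemainder SO3 isCompactSimpleLieGroup_SO3 r hr

end Summit.QuantumFields.YangMills.Theorems.FreeEnergyWindowChannel.Negative

end
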